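import Summits.FinalStateConjecture.FinalStateConjecture.Theorems.ClusterCompletenessOmegaLimitMultiKerrTranslates
import Literature.Analysis.Calculus.SmoothArzelaAscoli
import Literature.Geometry.Lorentzian.BilinPullbackEstimates
import HarnessLib

/-!
# Route ClusterCompleteness · crux `OmegaLimitMultiKerr` — SMOOTH ω-limits of the late-time
# translates of a field bounded at EVERY order (the `C^∞` Arzelà–Ascoli theorem on translates)

Structure lemma for the crux stmt-FinalStateConjecture-14664 (`ClusterCompleteness.OmegaLimitMultiKerr`,
rank 9), line `Sketch`, lead gen 3, stub `exists_strictMono_tendsto_supCkENorm_translate_sub_smooth`.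
The identification chain of the LaSalle reading of the crux extracts ω-limits
`g = lim h (· + Tₙ • w)` of the translated chart deviations of TAME charts
(`exists_strictMono_tendsto_supCkENorm_translate_sub`, `exists_omegaLimit_translate_of_bounded_truncLateRegion`,
`exists_omegaLimit_hole_translate`: `C^{k+1}` bounds ⇒ `Cᵏ` limits) and then uses that the vacuum
equations are closed under `C²` limits (`ricAt_eq_zero_of_tendsto_supCkENorm`), which needs the LIMIT
to be a field of metric components — in particular `C^∞`. A `Cᵏ_loc` limit of smooth fields is only
`Cᵏ`; this file closes the gap under tameness at ALL orders (the natural hypothesis for smooth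
developments): the `C^∞` Arzelà–Ascoli theorem of the tree
(`exists_strictMono_contDiffOn_infty_tendstoLocallyUniformlyOn_iteratedFDeriv`,
`Literature/Analysis/Calculus/SmoothArzelaAscoli.lean`) applied to the translates gives `C^∞`
ω-limits to which the translates converge in EVERY `Cᵏ` on every compact set (the conversion from
locally uniform convergence of all derivatives to the `supCkENorm` currency is the first item).

* `tendsto_supCkENorm_sub_of_tendstoUniformlyOn_iteratedFDeriv`,
  `tendsto_supCkENorm_sub_of_tendstoLocallyUniformlyOn_iteratedFDeriv` — the conversion from
  (locally) uniform convergence of the derivatives of order `≤ k` (the currency of the Arzelà–Ascoli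
  files of `Literature/Analysis`) to `supCkENorm K k (fⱼ − g) → 0` on compacts (the currency of the
  crux files).
* `exists_strictMono_tendsto_supCkENorm_translate_sub_smooth_of_isCompact` — the all-orders analogue
  of `exists_strictMono_tendsto_supCkENorm_translate_sub`: `h` smooth on an open set `O` forward-invariant
  under `x ↦ x + s • w` (`s ≥ 0`), `T n ≥ 0`, and for every order `i` and compact `K ⊆ O` a bound on
  `Dⁱ h (· + T n • w)` over `K` for all large `n` ⇒ along a subsequence the translates converge in every
  `Cᵏ` on every compact subset of `O` to a `C^∞` field `g` on `O`.
* `exists_strictMono_tendsto_supCkENorm_translate_sub_smooth` (registered stub, closed form) — the same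
  under UNIFORM all-order bounds `‖Dⁱ h (z + T n • w)‖ ≤ Λᵢ` (`z ∈ O`, all `n`), and
  `…_of_forall_mem` — under all-order bounds of `h` itself on `O` (forward invariance moves them to the
  translates).
* `exists_smoothOmegaLimit_translate_of_bounded_truncLateRegion` — the background form: all-order bounds
  on the truncated late regions `{t > τ₀, r ≤ R}` of a `ModelBackground` with a time translation `e`
  ⇒ smooth ω-limits along every `T n → +∞` (a compact set of the domain has bounded time and radius, so
  its late translates lie in one truncated late region: the bounds needed are only eventual per compact,
  which `…_of_isCompact` accepts), and `exists_smoothOmegaLimit_hole_translate` — hole charts on boosted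
  Kerr backgrounds whose deviation has finite `Cᵏ` sup norm on every truncated late region for every `k`.

Petersen 2006, Ch. 10, §3.1–3.2 (Arzelà–Ascoli at all orders; smooth Cheeger–Gromov limits need bounds
at all orders); Hale 1980, Ch. I, §8 (ω-limit sets of precompact orbits). Everything is proved;
Mathlib + landed `Literature` / `Theorems` files only.
-/

-- every `Summit.FinalStateConjecture.FinalStateConjecture.…` name repeats the summit = sub-problem segment (D-0017 layout)
set_option linter.dupNamespace false

noncomputable section

open scoped Manifold ContDiff Topology ENNReal
open Set Filter TopologicalSpace

namespace Summit.FinalStateConjecture.FinalStateConjecture.Theorems.ClusterCompleteness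

open Literature.Geometry.Lorentzian

/-! ### From (locally) uniform convergence of derivatives to `supCkENorm`-convergence -/

section Conversion

variable {F W : Type*} [NormedAddCommGroup F] [NormedSpace ℝ F] [NormedAddCommGroup W]
  [NormedSpace ℝ W]

/-- **`Cᵏ` sup-norm convergence from uniform convergence of the derivatives of order `≤ k`.** If
`Dⁱ fⱼ → Dⁱ g` uniformly on `K` for every `i ≤ k`, and the `fⱼ`, `g` are `Cᵏ` at the points of `K`,
then `supCkENorm K k (fⱼ − g) → 0` (finitely many orders, `Finset.eventually_all`; then the
introduction rule `supCkENorm_le_ofReal` and `iteratedFDeriv_sub_apply`). [folklore] -/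
theorem tendsto_supCkENorm_sub_of_tendstoUniformlyOn_iteratedFDeriv {k : ℕ} {f : ℕ → F → W}
    {g : F → W} {K : Set F} (hf : ∀ j, ∀ x ∈ K, ContDiffAt ℝ k (f j) x)
    (hg : ∀ x ∈ K, ContDiffAt ℝ k g x)
    (h : ∀ i, i ≤ k → TendstoUniformlyOn (fun j ↦ iteratedFDeriv ℝ i (f j)) (iteratedFDeriv ℝ i g)
      atTop K) :
    Tendsto (fun j ↦ supCkENorm K k (f j - g)) atTop (𝓝 0) := by
  rw [ENNReal.tendsto_nhds_zero]
  intro ε hε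
  rcases eq_top_or_lt_top ε with rfl | hεtop
  · exact Eventually.of_forall fun _ ↦ le_top
  have hεr : 0 < ε.toReal := ENNReal.toReal_pos hε.ne' hεtop.ne
  -- finitely many orders: eventually all derivatives of order `≤ k` are `ε`-close on `K`
  have h' : ∀ i ∈ Finset.range (k + 1), ∀ᶠ j in atTop, ∀ x ∈ K,
      ‖iteratedFDeriv ℝ i (f j) x - iteratedFDeriv ℝ i g x‖ < ε.toReal := fun i hi ↦ by
    have hu := h i (Nat.lt_succ_iff.1 (Finset.mem_range.1 hi))
    rw [Metric.tendstoUniformlyOn_iff] at hu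
    filter_upwards [hu ε.toReal hεr] with j hj x hx
    rw [← dist_eq_norm, dist_comm]
    exact hj x hx
  filter_upwards [(Finset.eventually_all (Finset.range (k + 1))).2 h'] with j hj
  rw [← ENNReal.ofReal_toReal hεtop.ne]
  refine supCkENorm_le_ofReal fun m hm x hx ↦ ?_
  rw [iteratedFDeriv_sub_apply ((hf j x hx).of_le (by exact_mod_cast hm))
    ((hg x hx).of_le (by exact_mod_cast hm))]
  exact (hj m (Finset.mem_range.2 (Nat.lt_succ_of_le hm)) x hx).le

/-- **`Cᵏ` sup-norm convergence on compacts from locally uniform convergence of the derivatives of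
order `≤ k` on an open set** (the conclusion of the `Cᵏ` / `C^∞` Arzelà–Ascoli theorems of
`Literature/Analysis`, converted to the `supCkENorm` currency): if the `fⱼ`, `g` are `Cᵏ` on the open
set `U` and `Dⁱ fⱼ → Dⁱ g` locally uniformly on `U` for every `i ≤ k`, then
`supCkENorm K k (fⱼ − g) → 0` for every compact `K ⊆ U`. [folklore] -/
theorem tendsto_supCkENorm_sub_of_tendstoLocallyUniformlyOn_iteratedFDeriv {k : ℕ} {f : ℕ → F → W}
    {g : F → W} {U : Set F} (hU : IsOpen U) (hf : ∀ j, ContDiffOn ℝ k (f j) U)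
    (hg : ContDiffOn ℝ k g U)
    (h : ∀ i, i ≤ k → TendstoLocallyUniformlyOn (fun j ↦ iteratedFDeriv ℝ i (f j))
      (iteratedFDeriv ℝ i g) atTop U) {K : Set F} (hKU : K ⊆ U) (hK : IsCompact K) :
    Tendsto (fun j ↦ supCkENorm K k (f j - g)) atTop (𝓝 0) :=
  tendsto_supCkENorm_sub_of_tendstoUniformlyOn_iteratedFDeriv
    (fun j _ hx ↦ (hf j).contDiffAt (hU.mem_nhds (hKU hx)))
    (fun _ hx ↦ hg.contDiffAt (hU.mem_nhds (hKU hx))) fun i hi ↦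
    (tendstoLocallyUniformlyOn_iff_tendstoUniformlyOn_of_compact hK).1 ((h i hi).mono hKU)

end Conversion

/-! ### Smooth ω-limits of translates under all-order bounds -/

section Translates

variable {E : Type*} [NormedAddCommGroup E] [NormedSpace ℝ E] [FiniteDimensional ℝ E]
  {W : Type*} [NormedAddCommGroup W] [NormedSpace ℝ W] [FiniteDimensional ℝ W]

open Literature.Analysis.Calculus in
/-- **Smooth ω-limits of late-time translates under eventual all-order bounds on compacts.** For `h`
of class `C^∞` on an open set `O` forward-invariant under `x ↦ x + s • w` (`s ≥ 0`) and nonnegative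
times `T n` such that, for every order `i` and every compact `K ⊆ O`, the derivatives `Dⁱ` of the
translates `h (· + T n • w)` are bounded on `K` uniformly in all large `n`, a subsequence of translates
converges in EVERY `Cᵏ` on every compact subset of `O` to a `C^∞` field on `O` (the `C^∞`
Arzelà–Ascoli theorem `exists_strictMono_contDiffOn_infty_tendstoLocallyUniformlyOn_iteratedFDeriv`
applied to the translates, then `tendsto_supCkENorm_sub_of_tendstoLocallyUniformlyOn_iteratedFDeriv`;
translation commutes with `iteratedFDeriv`, and the finitely many early translates are bounded on
compacts by continuity). The all-orders analogue of
`exists_strictMono_tendsto_supCkENorm_translate_sub`. [cite: Petersen2006, Ch. 10 §3.1] -/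
theorem exists_strictMono_tendsto_supCkENorm_translate_sub_smooth_of_isCompact {O : Set E}
    (hO : IsOpen O) {w : E} (hOw : ∀ x ∈ O, ∀ s : ℝ, 0 ≤ s → x + s • w ∈ O) {h : E → W}
    (hh : ContDiffOn ℝ ∞ h O) {T : ℕ → ℝ} (hT : ∀ n, 0 ≤ T n)
    (hb : ∀ (i : ℕ), ∀ K ⊆ O, IsCompact K → ∃ Λ : ℝ, ∀ᶠ n in atTop, ∀ z ∈ K,
      ‖iteratedFDeriv ℝ i h (z + T n • w)‖ ≤ Λ) :
    ∃ (g : E → W) (φ : ℕ → ℕ), StrictMono φ ∧ ContDiffOn ℝ ∞ g O ∧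
      ∀ (k : ℕ), ∀ K ⊆ O, IsCompact K →
        Tendsto (fun n ↦ supCkENorm K k (fun x ↦ h (x + T (φ n) • w) - g x)) atTop (𝓝 0) := by
  -- the translates
  set G : ℕ → E → W := fun n x ↦ h (x + T n • w) with hGdef
  have hmaps : ∀ n, MapsTo (fun x : E ↦ x + T n • w) O O := fun n x hx ↦ hOw x hx _ (hT n)
  have hG : ∀ n, ContDiffOn ℝ ∞ (G n) O := fun n ↦
    hh.comp ((contDiff_id.add contDiff_const).contDiffOn) (hmaps n)
  have hiter : ∀ n i z, iteratedFDeriv ℝ i (G n) z = iteratedFDeriv ℝ i h (z + T n • w) :=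
    fun n i z ↦ iteratedFDeriv_comp_add_right i (T n • w) z
  -- continuity of all derivatives of `h` on `O`
  have hcont : ∀ i : ℕ, ContinuousOn (iteratedFDeriv ℝ i h) O := by
    intro i
    have h1 : ContinuousOn (iteratedFDerivWithin ℝ i h O) O :=
      hh.continuousOn_iteratedFDerivWithin (by exact_mod_cast le_top) hO.uniqueDiffOn
    exact h1.congr fun x hx ↦ (iteratedFDerivWithin_of_isOpen i hO hx).symm
  -- common bounds on compacts for ALL `n`, order by order
  have hb' : ∀ (i : ℕ), ∀ K ⊆ O, IsCompact K →
      ∃ Λ : ℝ, ∀ n, ∀ z ∈ K, ‖iteratedFDeriv ℝ i (G n) z‖ ≤ Λ := by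
    intro i K hKO hK
    obtain ⟨Λ₀, hΛ₀⟩ := hb i K hKO hK
    obtain ⟨N, hN⟩ := eventually_atTop.1 hΛ₀
    -- each early translate is bounded on `K` by continuity
    have hsingle : ∀ n, ∃ C : ℝ, ∀ z ∈ K, ‖iteratedFDeriv ℝ i (G n) z‖ ≤ C := by
      intro n
      have hKn : IsCompact ((fun x : E ↦ x + T n • w) '' K) :=
        hK.image (continuous_id.add continuous_const)
      have hKnO : (fun x : E ↦ x + T n • w) '' K ⊆ O := by
        rintro _ ⟨x, hx, rfl⟩
        exact hmaps n (hKO hx)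
      obtain ⟨C, hC⟩ := hKn.exists_bound_of_continuousOn ((hcont i).mono hKnO)
      refine ⟨C, fun z hz ↦ ?_⟩
      rw [hiter]
      exact hC _ (mem_image_of_mem _ hz)
    choose C hC using hsingle
    refine ⟨max Λ₀ (∑ n ∈ Finset.range N, |C n|), fun n z hz ↦ ?_⟩
    rcases le_or_gt N n with hn | hn
    · rw [hiter]
      exact (hN n hn z hz).trans (le_max_left _ _)
    · refine le_trans ?_ (le_max_right _ _)
      calc ‖iteratedFDeriv ℝ i (G n) z‖ ≤ C n := hC n z hz
        _ ≤ |C n| := le_abs_self _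
        _ ≤ ∑ m ∈ Finset.range N, |C m| :=
            Finset.single_le_sum (f := fun m ↦ |C m|) (fun _ _ ↦ abs_nonneg _)
              (Finset.mem_range.2 hn)
  obtain ⟨g, φ, hφ, hg, hlim⟩ :=
    exists_strictMono_contDiffOn_infty_tendstoLocallyUniformlyOn_iteratedFDeriv hO hG hb'
  refine ⟨g, φ, hφ, hg, fun k K hKO hK ↦ ?_⟩
  exact tendsto_supCkENorm_sub_of_tendstoLocallyUniformlyOn_iteratedFDeriv hO
    (fun j ↦ (hG (φ j)).of_le (by exact_mod_cast le_top)) (hg.of_le (by exact_mod_cast le_top))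
    (fun i _ ↦ hlim i) hKO hK

/-- **Registered structure stub (crux stmt-FinalStateConjecture-14664, line `Sketch`): smooth
ω-limits of late-time translates under UNIFORM all-order bounds.** For `h` of class `C^∞` on an open
set `O` forward-invariant under `x ↦ x + s • w` (`s ≥ 0`), nonnegative times `T n`, and for every
order `i` ONE bound `‖Dⁱ h (z + T n • w)‖ ≤ Λᵢ` for all `z ∈ O` and all `n` (what all-time all-order
tameness on a forward-invariant late region gives), a subsequence of the translates `h (· + T (φ n) • w)`
converges in every `Cᵏ` on every compact subset of `O` (`supCkENorm K k → 0` for all `k`) to a field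
`g` of class `C^∞` on `O` — so that the limit chart metrics are again smooth and the closedness of the
vacuum equations under `C²` limits applies to them. The `C^∞` Arzelà–Ascoli theorem on translates
(Petersen 2006, Ch. 10, §3.1; smooth limits need bounds at all orders, ibid. §3.2); closed form.
[cite: Petersen2006, Ch. 10 §3.1] -/
theorem exists_strictMono_tendsto_supCkENorm_translate_sub_smooth :
    ∀ {E : Type*} [NormedAddCommGroup E] [NormedSpace ℝ E] [FiniteDimensional ℝ E]
      {W : Type*} [NormedAddCommGroup W] [NormedSpace ℝ W] [FiniteDimensional ℝ W] {O : Set E},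
      IsOpen O → ∀ {w : E}, (∀ x ∈ O, ∀ s : ℝ, 0 ≤ s → x + s • w ∈ O) →
      ∀ {h : E → W}, ContDiffOn ℝ ∞ h O → ∀ {T : ℕ → ℝ}, (∀ n, 0 ≤ T n) →
      (∀ i : ℕ, ∃ Λ : ℝ, ∀ n, ∀ z ∈ O, ‖iteratedFDeriv ℝ i h (z + T n • w)‖ ≤ Λ) →
      ∃ (g : E → W) (φ : ℕ → ℕ), StrictMono φ ∧ ContDiffOn ℝ ∞ g O ∧
        ∀ (k : ℕ), ∀ K ⊆ O, IsCompact K →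
          Tendsto (fun n ↦ supCkENorm K k (fun x ↦ h (x + T (φ n) • w) - g x)) atTop (𝓝 0) := by
  intro E _ _ _ W _ _ _ O hO w hOw h hh T hT hb
  refine exists_strictMono_tendsto_supCkENorm_translate_sub_smooth_of_isCompact hO hOw hh hT
    fun i K hKO _ ↦ ?_
  obtain ⟨Λ, hΛ⟩ := hb i
  exact ⟨Λ, Eventually.of_forall fun n z hz ↦ hΛ n z (hKO hz)⟩

/-- **Smooth ω-limits of translates from all-order bounds of the field itself** on the
forward-invariant open set: `‖Dⁱ h z‖ ≤ Λᵢ` on `O` bounds every translate `h (· + T n • w)`, `T n ≥ 0`,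
on `O` (forward invariance), so `exists_strictMono_tendsto_supCkENorm_translate_sub_smooth` applies.
[cite: Petersen2006, Ch. 10 §3.1] -/
theorem exists_strictMono_tendsto_supCkENorm_translate_sub_smooth_of_forall_mem {O : Set E}
    (hO : IsOpen O) {w : E} (hOw : ∀ x ∈ O, ∀ s : ℝ, 0 ≤ s → x + s • w ∈ O) {h : E → W}
    (hh : ContDiffOn ℝ ∞ h O) {T : ℕ → ℝ} (hT : ∀ n, 0 ≤ T n)
    (hb : ∀ i : ℕ, ∃ Λ : ℝ, ∀ z ∈ O, ‖iteratedFDeriv ℝ i h z‖ ≤ Λ) :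
    ∃ (g : E → W) (φ : ℕ → ℕ), StrictMono φ ∧ ContDiffOn ℝ ∞ g O ∧
      ∀ (k : ℕ), ∀ K ⊆ O, IsCompact K →
        Tendsto (fun n ↦ supCkENorm K k (fun x ↦ h (x + T (φ n) • w) - g x)) atTop (𝓝 0) :=
  exists_strictMono_tendsto_supCkENorm_translate_sub_smooth hO hOw hh hT fun i ↦ by
    obtain ⟨Λ, hΛ⟩ := hb i
    exact ⟨Λ, fun n z hz ↦ hΛ _ (hOw z hz _ (hT n))⟩

end Translates

/-! ### The background form: all-order bounds on truncated late regions -/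

/-- **Smooth late-time ω-limits along every `T n → ∞` for a field bounded at every order on the
truncated late regions of a background with a time-translation vector `e`.** Hypotheses as in
`exists_omegaLimit_translate_of_bounded_truncLateRegion` (the domain of `B` is `e`-invariant, time is
shifted and radius preserved by the translation, both continuous), but with `h` of class `C^∞` on the
domain and, for EVERY order `i` and every `R`, a bound on `Dⁱ h` over `{t > τ₀, r ≤ R}`. Conclusion:
along a subsequence of any `T n → +∞` the translates `h (· + T (φ n) • e)` converge in every `Cᵏ` on
every compact subset of the domain to a `C^∞` field `g` on the domain. A compact `K` of the domain has
bounded time and radius, so its translates by `T n • e` lie in one truncated late region for all large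
`n`; hence the eventual per-compact all-order bounds of
`exists_strictMono_tendsto_supCkENorm_translate_sub_smooth_of_isCompact` (Hale 1980, Ch. I, §8;
Petersen 2006, Ch. 10, §3.1). [cite: Petersen2006, Ch. 10 §3.1] -/
theorem exists_smoothOmegaLimit_translate_of_bounded_truncLateRegion
    {W : Type*} [NormedAddCommGroup W] [NormedSpace ℝ W] [FiniteDimensional ℝ W]
    (B : ModelBackground) (e : E4)
    (hdom : ∀ x ∈ (B.domain : Set E4), ∀ s : ℝ, x + s • e ∈ (B.domain : Set E4))
    (htime : ∀ (x : E4) (s : ℝ), B.time (x + s • e) = B.time x + s)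
    (hrad : ∀ (x : E4) (s : ℝ), B.radius (x + s • e) = B.radius x)
    (htc : Continuous B.time) (hrc : Continuous B.radius)
    {h : E4 → W} (hh : ContDiffOn ℝ ∞ h (B.domain : Set E4)) {τ₀ : ℝ}
    (hb : ∀ (i : ℕ) (R : ℝ), ∃ C : ℝ,
      ∀ x ∈ Subtype.val '' B.truncLateRegion τ₀ R, ‖iteratedFDeriv ℝ i h x‖ ≤ C)
    {T : ℕ → ℝ} (hT : Tendsto T atTop atTop) :
    ∃ (g : E4 → W) (φ : ℕ → ℕ), StrictMono φ ∧ ContDiffOn ℝ ∞ g (B.domain : Set E4) ∧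
      ∀ (k : ℕ), ∀ K ⊆ (B.domain : Set E4), IsCompact K →
        Tendsto (fun n ↦ supCkENorm K k (fun x ↦ h (x + T (φ n) • e) - g x)) atTop (𝓝 0) := by
  -- nonnegative times agreeing with `T` eventually
  set T' : ℕ → ℝ := fun n ↦ max (T n) 0 with hT'def
  have hT'0 : ∀ n, 0 ≤ T' n := fun n ↦ le_max_right _ _
  have hT' : Tendsto T' atTop atTop := tendsto_atTop_mono (fun n ↦ le_max_left _ _) hT
  have hTT' : ∀ᶠ n in atTop, T' n = T n := by
    filter_upwards [hT.eventually_ge_atTop 0] with n hn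
    exact max_eq_left hn
  have hO : IsOpen (B.domain : Set E4) := B.domain.isOpen
  have hOw : ∀ x ∈ (B.domain : Set E4), ∀ s : ℝ, 0 ≤ s → x + s • e ∈ (B.domain : Set E4) :=
    fun x hx s _ ↦ hdom x hx s
  -- eventual common bounds on the translates of a compact set, order by order
  have hb' : ∀ (i : ℕ), ∀ K ⊆ (B.domain : Set E4), IsCompact K → ∃ Λ : ℝ, ∀ᶠ n in atTop,
      ∀ z ∈ K, ‖iteratedFDeriv ℝ i h (z + T' n • e)‖ ≤ Λ := by
    intro i K hKO hK
    obtain ⟨t₀, ht₀⟩ := hK.bddBelow_image htc.continuousOn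
    obtain ⟨R₀, hR₀⟩ := hK.bddAbove_image hrc.continuousOn
    obtain ⟨C, hC⟩ := hb i R₀
    refine ⟨C, ?_⟩
    filter_upwards [hT'.eventually_gt_atTop (τ₀ - t₀)] with n hn z hz
    refine hC _ ⟨⟨z + T' n • e, hdom z (hKO hz) _⟩, ⟨?_, ?_⟩, rfl⟩
    · have h1 : t₀ ≤ B.time z := ht₀ (mem_image_of_mem _ hz)
      show τ₀ < B.time (z + T' n • e)
      rw [htime]
      linarith
    · have h2 : B.radius z ≤ R₀ := hR₀ (mem_image_of_mem _ hz)
      show B.radius (z + T' n • e) ≤ R₀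
      rwa [hrad]
  obtain ⟨g, φ, hφ, hg, hlim⟩ :=
    exists_strictMono_tendsto_supCkENorm_translate_sub_smooth_of_isCompact hO hOw hh hT'0 hb'
  refine ⟨g, φ, hφ, hg, fun k K hKO hK ↦ ?_⟩
  have hev : ∀ᶠ n in atTop, T' (φ n) = T (φ n) := hφ.tendsto_atTop.eventually hTT'
  refine (hlim k K hKO hK).congr' ?_
  filter_upwards [hev] with n hn
  rw [hn]

/-- **Smooth ω-limits of hole charts that are tame at every order.** Let `Ψ` be a smooth chart on the
boosted Kerr background `B = boostedKerrBackground Λ c M a` whose deviation `Ψ^* g − g_{M,a}` (extended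
by zero) has finite `Cᵏ` sup norm over every truncated late region `{t* > τ₀, r ≤ R}` for EVERY `k`.
Then for every sequence of chart times `T n → +∞` there are a field `g` of class `C^∞` on the boosted
exterior and a subsequence `φ` along which the translates `x ↦ (Ψ^* g − g_{M,a})(x + T (φ n) • Λ∂₀)`
converge to `g` in every `Cᵏ` on every compact subset of the exterior (the all-orders version of
`exists_omegaLimit_hole_translate`, through `exists_smoothOmegaLimit_translate_of_bounded_truncLateRegion`).
[cite: Petersen2006, Ch. 10 §3.1] -/
theorem exists_smoothOmegaLimit_hole_translate (𝓢 : Spacetime 4) (Λ : lorentzGroup) (c : E4)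
    (M a : ℝ) {Ψ : (boostedKerrBackground Λ c M a).domain → 𝓢.carrier}
    (hΨ : ContMDiff 𝓘(ℝ, E4) (𝓡 4) ∞ Ψ) {τ₀ : ℝ}
    (hfin : ∀ (k : ℕ) (R : ℝ),
      supCkENorm (Subtype.val '' (boostedKerrBackground Λ c M a).truncLateRegion τ₀ R) k
        (𝓢.deviationExtend (boostedKerrBackground Λ c M a) Ψ) ≠ ⊤)
    {T : ℕ → ℝ} (hT : Tendsto T atTop atTop) :
    ∃ (g : E4 → E4 →L[ℝ] E4 →L[ℝ] ℝ) (φ : ℕ → ℕ), StrictMono φ ∧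
      ContDiffOn ℝ ∞ g (boostedKerrExterior Λ c M a : Set E4) ∧
      ∀ (k : ℕ), ∀ K ⊆ (boostedKerrExterior Λ c M a : Set E4), IsCompact K →
        Tendsto (fun n ↦ supCkENorm K k (fun x ↦
          𝓢.deviationExtend (boostedKerrBackground Λ c M a) Ψ
            (x + T (φ n) • (Λ : E4 ≃L[ℝ] E4) (EuclideanSpace.single (0 : Fin 4) (1 : ℝ))) - g x))
          atTop (𝓝 0) := by
  -- continuity of the rest-frame chart time and radius
  have htc : Continuous (boostedKerrBackground Λ c M a).time :=
    (PiLp.continuous_apply 2 _ 0).comp (continuous_poincareInv Λ c)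
  have hrc : Continuous (boostedKerrBackground Λ c M a).radius :=
    (Kerr.continuous_radius a).comp (continuous_poincareInv Λ c)
  -- tameness at every order: pointwise bounds from the finite sup norms
  have hb : ∀ (i : ℕ) (R : ℝ), ∃ C : ℝ,
      ∀ x ∈ Subtype.val '' (boostedKerrBackground Λ c M a).truncLateRegion τ₀ R,
        ‖iteratedFDeriv ℝ i (𝓢.deviationExtend (boostedKerrBackground Λ c M a) Ψ) x‖ ≤ C :=
    fun i R ↦ ⟨_, fun _ hx ↦ norm_iteratedFDeriv_le_toReal_supCkENorm le_rfl hx _ (hfin i R)⟩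
  exact exists_smoothOmegaLimit_translate_of_bounded_truncLateRegion (boostedKerrBackground Λ c M a)
    ((Λ : E4 ≃L[ℝ] E4) (EuclideanSpace.single (0 : Fin 4) (1 : ℝ)))
    (add_smul_mem_boostedKerrBackground_domain Λ c M a) (KerrSchildChart.time_add_smul Λ c M a)
    (KerrSchildChart.radius_add_smul Λ c M a) htc hrc (contDiffOn_deviationExtend_boostedKerr 𝓢 hΨ)
    hb hT

end Summit.FinalStateConjecture.FinalStateConjecture.Theorems.ClusterCompleteness

end
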